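import Mathlib.Analysis.InnerProductSpace.PiL2
import Literature.Algebra.EuclideanLattices.LatticeComplexity
import Literature.Computability.Complexity.Promise
import Literature.Computability.Cryptography.OneWayFunctions
import Literature.Computability.Cryptography.SIS
import Mathlib.Analysis.SpecificLimits.Basic
import Mathlib.Order.Filter.Cofinite
import HarnessLib

/-!
# Named fact: worst-case hardness of `GapSVP` within polynomial factors gives one-way functions

Grounder file (D-0014 named facts) for the route `PneNP/Lattice`, statement item stmt-PneNP-0186
(`lattice_gapsvp_hard_implies_owf`).

Ajtai (STOC 1996, Thm. 1) showed that if there is no probabilistic polynomial-time algorithm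
approximating the shortest vector of an `n`-dimensional integer lattice within a factor `n^c`
(for a suitable absolute `c`) in the worst case, then the short-integer-solution function
`f_A(x) = A x mod q` is one-way (indeed collision resistant: Goldreich–Goldwasser–Halevi 1996);
Micciancio–Regev (SIAM J. Comput. 37 (2007), §5.4, Thm. 5.23 of the full version, p. 28: "solving
SIS′ on the average is at least as hard as solving GapSVP_γ in the worst case", γ = O(n√log n))
bring the factor down to `Õ(n)` via Gaussian measures, and Micciancio–Goldwasser (2002, Ch. 8) /
Peikert (2016, §4.1, Thm. 4.1.2) give textbook accounts. The item's hypothesis —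
`GapSVP_γ ∉ PromiseBPP` for EVERY polynomially bounded `γ ≥ 1` — contains the specific polynomial factor of these theorems; but the printed reductions
only give the INFINITELY-OFTEN, PROMISE-ONLY form recorded below (see the docstring of
`owfExist_of_gapSVP_worstCaseHard`): hardness must be assumed on every infinite set of
dimensions and against textbook promise-BPP (`PromiseBPP'`).

Nothing is asserted; users take `(h : Literature.PQC.owfExist_of_gapSVP_worstCaseHard)`.

## Decomposition (D-0014 provefact; second part of this file)

The SIS side is now typed (`Literature/Computability/Cryptography/SIS.lean`) and the fact is
REDUCED here, by a proved theorem, to two named facts closer to print — Micciancio–Regev's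
Thm. 5.23 (`MicciancioRegev2007_gapSVP_to_SIS'`, GapSVP_γ → SIS′ on the average, dimension-wise)
and the SIS-function step (`Ajtai1996_sisFunction_inverter_to_SIS'`, inverters of Ajtai's
packaged function give SIS′ solvers):
`owfExist_of_gapSVP_worstCaseHard_of_MR07 (h1 : …SIS') (h2 : Ajtai1996…) : owfExist_of_gapSVP_worstCaseHard`
(glue lemmas proved). The sibling `SISFunction.lean` makes the second fact concrete (one
explicit function). `owfExist_of_gapSVP_worstCaseHard` itself stays a named fact until the two
leaves are discharged (TM2-level PPT reductions; MR07 §3–5).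

## References

* M. Ajtai, *Generating hard instances of lattice problems*, STOC 1996, 99–108, Thm. 1.
* D. Micciancio, O. Regev, *Worst-case to average-case reductions based on Gaussian measures*,
  SIAM J. Comput. 37 (2007), 267–302, §5.4 Thm. 5.23 (GapSVP → SIS′), Def. 2.2 (GapSVP).
* D. Micciancio, S. Goldwasser, *Complexity of Lattice Problems*, Kluwer 2002, Ch. 8.
* C. Peikert, *A decade of lattice cryptography*, Found. Trends TCS 10 (2016), §4.1.
-/

noncomputable section

namespace Literature.Computability.Cryptography

/-- NAMED FACT (Ajtai 1996 Thm. 1; Micciancio–Regev 2007 §5.4 Thm. 5.23; Micciancio–Goldwasser 2002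
Ch. 8; grounds `Summit.PneNP.PneNP.Theses.Lattice.LatticeGapsvpHardImpliesOwf` once that item is
re-signed to this hypothesis — reground note on stmt-PneNP-0186),
in the form the printed reductions actually give. The reduction turns a PPT inverter of the SIS
function that succeeds for INFINITELY MANY security parameters `n` (the negation of
`CryptoQuantFine.IsOneWay`, Goldreich 2001 Def. 2.2.1) into a probabilistic polynomial-time
algorithm deciding `GapSVP_γ` correctly (error `≤ 1/3`) ON THE PROMISE, in the corresponding
infinitely many dimensions. Hence the faithful contrapositive: if for every polynomially bounded
`γ ≥ 1` and every infinite set `S` of dimensions the restriction of `GapSVP_γ` to dimensions in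
`S` is not in textbook promise-BPP (`CplxCore.PromiseBPP'`, bounded error required on the promise
only), then one-way functions exist (`CryptoQuantFine.OWFExist`). (The earlier vendored form with
hypothesis `gapSVPPromise γ ∉ CplxCore.PromiseBPP` — all dimensions at once, and the lifted class
`promiseLift BPP` — is NOT what the printed theorems give: it ignores the infinitely-often /
almost-everywhere gap and the promise-only error guarantee; refuter note on stmt-PneNP-0186.)
Only one polynomial factor (`n^c`, resp. `Õ(n)`) is used by the printed theorems; security
parameter and lattice dimension are polynomially related there, absorbed here by quantifying over
all infinite `S`. Users take `(h : owfExist_of_gapSVP_worstCaseHard)`. [cite: MicciancioRegev2007, Thm 5.23 (§5.4; with Ajtai 1996 Thm 1)] -/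
def owfExist_of_gapSVP_worstCaseHard : Prop :=
  (∀ γ : ℕ → ℝ, Literature.Algebra.EuclideanLattices.IsPolyBoundedReal γ → (∀ n, 1 ≤ γ n) → ∀ S : Set ℕ, S.Infinite →
      Complexity.PromiseProblem.ofEncoding Literature.Algebra.EuclideanLattices.gapSVPInstanceEncoding
          {p | p ∈ Literature.Algebra.EuclideanLattices.GapSVP.yes γ ∧ p.1.n ∈ S}
          {p | p ∈ Literature.Algebra.EuclideanLattices.GapSVP.no γ ∧ p.1.n ∈ S} ∉ Complexity.PromiseBPP') →
    Cryptography.OWFExist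

/-- The faithful (infinitely-often, promise-BPP') hypothesis is implied by nothing weaker in the
tree; in particular the all-dimensions statement `gapSVPPromise γ ∉ PromiseBPP` used by route
PneNP/Lattice (stmt-PneNP-0186) does NOT feed this fact. Recorded for bookkeeping: restricting
to `S = univ` recovers the unrestricted promise problem. [folklore] -/
theorem ofEncoding_gapSVP_univ (γ : ℕ → ℝ) :
    Complexity.PromiseProblem.ofEncoding Literature.Algebra.EuclideanLattices.gapSVPInstanceEncoding
        {p | p ∈ Literature.Algebra.EuclideanLattices.GapSVP.yes γ ∧ p.1.n ∈ (Set.univ : Set ℕ)}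
        {p | p ∈ Literature.Algebra.EuclideanLattices.GapSVP.no γ ∧ p.1.n ∈ (Set.univ : Set ℕ)} = Literature.Algebra.EuclideanLattices.gapSVPPromise γ := by
  simp [Literature.Algebra.EuclideanLattices.gapSVPPromise, Literature.Algebra.EuclideanLattices.GapSVP.yes, Literature.Algebra.EuclideanLattices.GapSVP.no]

end Literature.Computability.Cryptography

end

noncomputable section

/-! ## Decomposition of `owfExist_of_gapSVP_worstCaseHard` (D-0014 provefact, XL)

The printed proof of the fact splits into (F1) Micciancio–Regev's worst-case/average-case
reduction GapSVP_γ → SIS′ (`Literature.Computability.Cryptography.MicciancioRegev2007_gapSVP_to_SIS'`, file `SIS.lean`),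
(F2) Ajtai's construction: a single polynomial-time function `g` (Goldreich's Def. 2.2.1
format) whose inverters yield average-case SIS′ solvers (named fact
`Ajtai1996_sisFunction_inverter_to_SIS'` below), and elementary glue (negation of negligible,
images of infinite sets, antitonicity of promise-BPP), all PROVED below, giving the assembly
`owfExist_of_gapSVP_worstCaseHard_of_MR07`. Discharging F1/F2 themselves needs the TM2-level
theory of PPT reductions and MR07 §3–5 (Gaussian measures); they stay named facts.
-/

namespace Literature.Computability.Cryptography

open Filter Asymptotics Topology Complexity Literature.Algebra.EuclideanLattices LWE

/-! ### Glue: negligible functions, infinite sets, promise-BPP -/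

/-- A nonnegative sequence that is NOT negligible is bounded below by an inverse polynomial on
an infinite set: `¬ (∀ c, kᶜ f(k) → 0)` gives `c` with `f(k) ≥ 1/kᶜ` for infinitely many `k`
(otherwise `f(k) < 1/k^{c}` eventually for every `c`, and `k^{c} f(k) ≤ 1/k → 0`).
[Goldreich 2001, §1.3.5 (negligible vs. noticeable functions)] [cite: Goldreich2001, Def. 1.3.5] -/
theorem exists_infinite_ge_inv_pow_of_not_superpolynomialDecay {f : ℕ → ℝ} (hf : ∀ k, 0 ≤ f k)
    (h : ¬ SuperpolynomialDecay atTop (fun k : ℕ => (k : ℝ)) f) :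
    ∃ c : ℕ, {k : ℕ | 1 / (k : ℝ) ^ c ≤ f k}.Infinite := by
  by_contra hfin
  push Not at hfin
  apply h
  intro z
  have hev : ∀ᶠ k : ℕ in atTop, f k < 1 / (k : ℝ) ^ (z + 1) := by
    have := (hfin (z + 1)).compl_mem_cofinite
    rw [Nat.cofinite_eq_atTop] at this
    filter_upwards [this] with k hk
    simpa using hk
  refine tendsto_of_tendsto_of_tendsto_of_le_of_le' tendsto_const_nhds
    tendsto_one_div_atTop_nhds_zero_nat ?_ ?_
  · filter_upwards with k
    exact mul_nonneg (by positivity) (hf k)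
  · filter_upwards [hev, eventually_ge_atTop 1] with k hk hk1
    have hkpos : (0 : ℝ) < k := by exact_mod_cast hk1
    calc (k : ℝ) ^ z * f k ≤ (k : ℝ) ^ z * (1 / (k : ℝ) ^ (z + 1)) := by
          gcongr
      _ = 1 / (k : ℝ) := by
          rw [pow_succ]; field_simp

/-- The image of an infinite set of naturals under a map tending to infinity is infinite.
[folklore] -/
theorem infinite_image_of_tendsto_atTop {nOf : ℕ → ℕ} (hn : Tendsto nOf atTop atTop) {K : Set ℕ}
    (hK : K.Infinite) : (nOf '' K).Infinite := by
  refine Set.infinite_of_not_bddAbove ?_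
  rintro ⟨M, hM⟩
  obtain ⟨N, hN⟩ := tendsto_atTop_atTop.1 hn (M + 1)
  obtain ⟨k, hkK, hNk⟩ := hK.exists_gt N
  have h1 : M + 1 ≤ nOf k := hN k hNk.le
  have h2 : nOf k ≤ M := hM ⟨k, hkK, rfl⟩
  omega

/-- Textbook promise-BPP is antitone in the promise: shrinking the YES and NO sets keeps a
promise problem in `PromiseBPP'` (the same machine works). [Goldreich 2006, §1.2] [cite: Goldreich2006, Def. 1.2 (promise-BPP)] -/
theorem mem_PromiseBPP'_of_subset {Q Q' : PromiseProblem} (hy : Q'.yes ≤ Q.yes)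
    (hn : Q'.no ≤ Q.no) (h : Q ∈ PromiseBPP') : Q' ∈ PromiseBPP' := by
  obtain ⟨L', hL', p, hyes, hno⟩ := h
  exact ⟨L', hL', p, fun x hx => hyes x (hy hx), fun x hx => hno x (hn hx)⟩

/-- Restricted `GapSVP` promise problems are antitone in the dimension set and in the factor:
for `γ ≤ γ'` and `S' ⊆ S`, membership of `GapSVP_γ|S` in `PromiseBPP'` gives membership of
`GapSVP_{γ'}|S'` (YES sets do not depend on the factor, NO sets shrink as the factor grows).
[Micciancio–Goldwasser 2002, Ch. 1, §1.2 (larger gap = easier problem)] [cite: MicciancioGoldwasser2002, Ch. 1  §1.2] -/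
theorem gapSVP_restrict_mem_PromiseBPP'_mono {γ γ' : ℕ → ℝ} (hγ : γ ≤ γ') {S S' : Set ℕ}
    (hS : S' ⊆ S)
    (h : PromiseProblem.ofEncoding gapSVPInstanceEncoding
        {p | p ∈ GapSVP.yes γ ∧ p.1.n ∈ S} {p | p ∈ GapSVP.no γ ∧ p.1.n ∈ S} ∈ PromiseBPP') :
    PromiseProblem.ofEncoding gapSVPInstanceEncoding
        {p | p ∈ GapSVP.yes γ' ∧ p.1.n ∈ S'} {p | p ∈ GapSVP.no γ' ∧ p.1.n ∈ S'} ∈ PromiseBPP' := by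
  refine mem_PromiseBPP'_of_subset ?_ ?_ h
  · change gapSVPInstanceEncoding.toLanguage _ ≤ gapSVPInstanceEncoding.toLanguage _
    refine Computability.Encoding.toLanguage_mono _ ?_
    rintro p ⟨hp, hpS⟩
    exact ⟨(GapSVP.yes_eq_yes γ γ') ▸ hp, hS hpS⟩
  · change gapSVPInstanceEncoding.toLanguage _ ≤ gapSVPInstanceEncoding.toLanguage _
    refine Computability.Encoding.toLanguage_mono _ ?_
    rintro p ⟨hp, hpS⟩
    exact ⟨GapSVP.no_subset_no_of_le hγ hp, hS hpS⟩

/-- `max 1 γ` is polynomially bounded when `γ` is. [Arora–Barak 2009, §1.6] [cite: AroraBarak2009, §1.6] -/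
theorem isPolyBoundedReal_max_one {γ : ℕ → ℝ} (h : IsPolyBoundedReal γ) :
    IsPolyBoundedReal fun n => max 1 (γ n) := by
  obtain ⟨p, hp⟩ := h
  refine ⟨p + 1, fun n => ?_⟩
  simp only [Polynomial.eval_add, Polynomial.eval_one, Nat.cast_add, Nat.cast_one]
  refine max_le ?_ ((hp n).trans (le_add_of_nonneg_right zero_le_one))
  have : (0 : ℝ) ≤ ((p.eval n : ℕ) : ℝ) := Nat.cast_nonneg _
  linarith

/-! ### F2: Ajtai's SIS function packaged as a single one-way-function candidate -/

/-- NAMED FACT (**Ajtai 1996 Thm. 1 / Micciancio–Regev 2007 §5.1 / Goldreich 2001 §2.4**;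
nothing is asserted, users take `(h : Ajtai1996_sisFunction_inverter_to_SIS')`).
The SIS-function step of "worst-case GapSVP hardness ⇒ one-way functions", in the format of
Goldreich's Def. 2.2.1 (ONE function `g : {0,1}* → {0,1}*`, security parameter = input
length). Printed ingredients: (i) MR07 §5.1 (full version p. 18): a collision `x ≠ y ∈ {0,1}^m`
of `f_A(x) = A x mod q` is a nonzero `z = x - y ∈ Λ_q(A)` of norm `≤ √m` — indeed an SIS′
solution, `SIS.isSolution'_sub_of_collision`; (ii) for compressing parameters
`m ≥ 2 n log₂ q` an inverter of `(A, x) ↦ (A, f_A x)` on uniformly random `(A, x)` returns a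
second preimage `x' ≠ x` except with probability `≤ qⁿ/2^m` (Ajtai 1996, Thm. 1;
Goldreich–Goldwasser–Halevi 1996; Peikert 2016 §4.1.1); (iii) Goldreich 2001, §2.4.1–2.4.2:
a collection `{f_A}` with polynomial-time samplable uniform keys is packaged as one function
`g(w)`: parse `w ∈ {0,1}^k` as `(A, x, pad)` for the largest admissible dimension `n = nOf k`
(with `q(n) = 2^{t(n)}` a power of two, so that uniform bits give a uniform `A ∈ ℤ_q^{n×m}`;
Thm. 5.23 needs no parity condition on `q`), output the code of `(A, f_A x, pad)`; an inverter
of `g` at length `k` is run by the SIS′ solver at dimension `n` on a uniformly guessed length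
`k` of the block `nOf⁻¹(n)` (polynomial loss). Lean rendering: there are parameter functions
`q, m, β` in the regime of MR07 Thm. 5.23 (`MRModulusCondition`, polynomially bounded,
`IsPolyTimeParams`, `β ≥ 1`), a polynomial-time computable `g` and a dimension map
`nOf → ∞` such that for every PPT `A` and exponent `c` there are a PPT `B` and `c', k₀` with:
for all `k ≥ k₀`, if `A` inverts `g` at security parameter `k` with probability `≥ 1/kᶜ`
(`CryptoQuantFine.invertProb`), then `B` solves SIS′_{q,m,β} in dimension `nOf k` on the
average with probability `≥ 1/(nOf k)^{c'}` (`SIS.successProb'`). The polynomial-time claims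
inside (matrix–vector product mod `2^t`, parsing, machine composition) are TM2-level facts.
[cite: MicciancioRegev2007, §5.1 (p. 18, family H_{q,m,d} and collision remark); with Ajtai 1996 Thm 1, Goldreich 2001 §2.4.2] -/
def Ajtai1996_sisFunction_inverter_to_SIS' : Prop :=
  ∃ (q m : ℕ → ℕ) (_ : ∀ n, NeZero (q n)) (β : ℕ → ℝ) (g : List Bool → List Bool) (nOf : ℕ → ℕ),
    IsPolyBounded q ∧ IsPolyBounded m ∧ IsPolyBoundedReal β ∧ IsPolyTimeParams q β m ∧
    (∀ n, 1 ≤ β n) ∧ MRModulusCondition q m β ∧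
    PolyTimeComputable id id g ∧ Tendsto nOf atTop atTop ∧
    ∀ A : RandAlg (List Bool) (List Bool), IsPPT A id → ∀ c : ℕ,
      ∃ B : RandAlg (List Bool) (List Bool), IsPPT B id ∧ ∃ c' k₀ : ℕ, ∀ k : ℕ, k₀ ≤ k →
        1 / (k : ℝ) ^ c ≤ invertProb g A k →
        1 / (nOf k : ℝ) ^ c' ≤ SIS.successProb' B (nOf k) (m (nOf k)) (q (nOf k)) (β (nOf k))

/-! ### Assembly -/

/-- **Assembly of the decomposition** (proved): Micciancio–Regev's Theorem 5.23 (F1,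
`MicciancioRegev2007_gapSVP_to_SIS'`) and Ajtai's SIS-function step (F2,
`Ajtai1996_sisFunction_inverter_to_SIS'`) imply the named fact
`owfExist_of_gapSVP_worstCaseHard`. Proof: the candidate is F2's `g`; if some PPT `A` inverts
it non-negligibly, then (glue) `A` succeeds with probability `≥ 1/kᶜ` on an infinite set `K`
of security parameters, F2 turns it into an average-case SIS′ solver on the infinite set of
dimensions `nOf '' (K ∩ [k₀, ∞))`, F1 puts `GapSVP_{14π√n β}` restricted to those dimensions
(`≥ n₀`) into `PromiseBPP'`, contradicting the hypothesis at the polynomially bounded factor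
`max 1 (14π√n β) ≥ 1` (antitonicity in factor and dimension set).
[Micciancio–Regev 2007, Thm. 5.23 and §5.1; Ajtai 1996, Thm. 1] [cite: MicciancioRegev2007, Thm. 5.23 (with §5.1; Ajtai 1996 Thm 1)] -/
theorem owfExist_of_gapSVP_worstCaseHard_of_MR07 (h1 : MicciancioRegev2007_gapSVP_to_SIS')
    (h2 : Ajtai1996_sisFunction_inverter_to_SIS') : owfExist_of_gapSVP_worstCaseHard := by
  intro H
  obtain ⟨q, m, hq0, β, g, nOf, hq, hm, hβ, hpar, hβ1, hmod, hg, hnOf, hred⟩ := h2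
  refine ⟨g, hg, fun A hA => ?_⟩
  by_contra hneg
  -- (glue) a polynomial inverse lower bound on an infinite set of security parameters
  obtain ⟨c, hK⟩ := exists_infinite_ge_inv_pow_of_not_superpolynomialDecay
    (fun k => invertProb_nonneg g A k) hneg
  set K : Set ℕ := {k : ℕ | 1 / (k : ℝ) ^ c ≤ invertProb g A k} with hKdef
  -- (F2) an average-case SIS′ solver on the corresponding dimensions
  obtain ⟨B, hB, c', k₀, hsolve⟩ := hred A hA c
  set S : Set ℕ := nOf '' (K ∩ Set.Ici k₀) with hSdef
  have hSinf : S.Infinite := infinite_image_of_tendsto_atTop hnOf (infinite_inter_Ici hK k₀)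
  have hS : ∀ n ∈ S, 1 / (n : ℝ) ^ c' ≤ SIS.successProb' B n (m n) (q n) (β n) := by
    rintro n ⟨k, ⟨hkK, hk₀⟩, rfl⟩
    exact hsolve k hk₀ hkK
  -- (F1) GapSVP restricted to those dimensions is in promise-BPP
  obtain ⟨n₀, hBPP⟩ := h1 q m β hq hm hβ hpar (fun n => one_pos.trans_le (hβ1 n)) hmod B hB c' S hS
  -- the hardness hypothesis at the factor `max 1 (mrGamma β)` on the infinite set `S ∩ Ici n₀`
  have hγpoly : IsPolyBoundedReal fun n => max 1 (mrGamma β n) :=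
    isPolyBoundedReal_max_one (isPolyBoundedReal_mrGamma hβ fun n => zero_le_one.trans (hβ1 n))
  refine H (fun n => max 1 (mrGamma β n)) hγpoly (fun n => le_max_left _ _) (S ∩ Set.Ici n₀)
    (infinite_inter_Ici hSinf n₀) ?_
  exact gapSVP_restrict_mem_PromiseBPP'_mono (fun n => le_max_right _ _) subset_rfl hBPP

end Literature.Computability.Cryptography

end
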